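import Literature.AlgebraicGeometry.HodgeTheory.FermatHodgeCharacterCriterion
import HarnessLib

/-!
# The Hodge condition at an odd conductor met at the exact levels `f`, `2f`, `4f` — Aoki 1983, Prop. 2.2

Topic `Literature/AlgebraicGeometry/HodgeTheory`. THEOREMS only (no definition, no named fact, no `sorry`).
Support file (XXI) extending `FermatHodgeCharacterExactLevel` (XVIII: odd conductor `f` met at the
exact levels `f`, `2f`) to the exact level `4f`, as needed for [Aoki1983, Thm. C] at the levels
`m = 4m'` (route K₄ of the cell's scoping document; Aoki's case `ord₂ m = 2`, §9 (V-1)–(V-2):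
"considering `τ_{2d₀}` instead of `τ_{d₀}` …", and (III-7), where `τ₄(α)` is taken).

For a Hodge character `α : Fin r → ℤ/m`, `αᵢ = (m/Mᵢ) wᵢ` (`Mᵢ ∣ m` the exact level, `wᵢ` a unit
mod `Mᵢ`), an ODD `f ∣ m` such that every `Mᵢ` divisible by `f` is `f`, `2f` or `4f`, and an odd
primitive character `χ` mod `f`, Aoki's criterion ([Aoki1983, Prop. 2.1/2.2]; the tree's
`IsHodge.aoki_criterion`) reads — **`IsHodge.rel_odd_conductor_conj`** —
`∑_{Mᵢ = 4f} (1 - χ(2)⁻¹) χ(w̄ᵢ) + 2 ∑_{Mᵢ = 2f} (1 - χ(2)⁻¹) χ(w̄ᵢ) + 2 ∑_{Mᵢ = f} χ(w̄ᵢ) = 0`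
(`w̄ᵢ = wᵢ mod f`; weights `φ(m)/φ(Mᵢ) ∝ 1, 2, 2`, Euler factor `1 - χ(2)` at the even levels;
complex conjugate form). With `2v = -1` in `ℤ/f`, `(1 - χ(2)⁻¹) χ(w̄) = χ(w̄) + χ(v w̄)`: the points
of level `4f` are twins of weight `1`, those of level `2f` twins of weight `2`, those of level `f`
single points of weight `2`.

WHERE XXI IS APPLIED (cell bookkeeping, 2026-08-25): `FermatSurfaceHodgeCharacterNoUnit`
(`pair_or_imprimitive_of_no_unit`, [Aoki1983, §9 (V)] at every level with `3 ∤ m`, hence the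
families K₄ `…FourTimesCoprimeSix` and K₈ `…EightDvd`); the `N = 0` files of the families with
`3 ∣ m` (`…TwiceThreeOddNoUnit`, `…FourTimesThreeOddNoUnit`, `…EightDvdThreeNoUnit`,
`…TwiceNineNoUnit`, `…FourTimesNineNoUnit`, `…EightDvdNineNoUnit`) re-derive this relation
privately from `IsHodge.aoki_criterion` (`rel_odd_conductor₈` etc.) and do not import this file.

HONEST FRAMING (cell `pub-hfermat`): explicit algebraic cycles for specific Hodge classes on
Fermat/Delsarte varieties; residual open instances listed; no claim on general Hodge. (Surface
classes are algebraic by Lefschetz (1,1); this file is a relation among Hodge characters, no case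
of HC.)

## References
* [Aoki1983] N. Aoki, *On some arithmetic problems related to the Hodge cycles on the Fermat varieties*,
  Math. Ann. 266 (1983) 23–54 — Props. 2.1, 2.2 (pp. 28–29), §9 (III-7) pp. 50–51, (V-1)–(V-2) p. 53.
-/

noncomputable section

open Finset

namespace Literature.AlgebraicGeometry.HodgeTheory

namespace FermatCharacter

section OddConductor

variable {m : ℕ}

/-- `χ` vanishes at the primes of its level: `∏_{p ∣ f} (1 - χ(p)) = 1`. [folklore] -/
private theorem prod_primeFactors_one_sub_eq_one' {f : ℕ} (χ : DirichletCharacter ℂ f) :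
    ∏ p ∈ f.primeFactors, (1 - χ (p : ZMod f)) = 1 := by
  refine Finset.prod_eq_one fun p hp ↦ ?_
  have hpf : p ∣ f := Nat.dvd_of_mem_primeFactors hp
  have hp1 : p.Prime := Nat.prime_of_mem_primeFactors hp
  have hnu : ¬ IsUnit ((p : ℕ) : ZMod f) := by
    rw [ZMod.isUnit_iff_coprime]
    intro hc
    exact hp1.one_lt.ne' (Nat.Coprime.eq_one_of_dvd hc hpf)
  rw [χ.map_nonunit hnu, sub_zero]

/-- **[Aoki1983, Prop. 2.2] at an odd conductor met only at the exact levels `f`, `2f`, `4f`.**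
Let `α = (α₀, …, α_{r-1})` be a Hodge character of level `m`, `αᵢ = (m/Mᵢ) wᵢ` with `Mᵢ ∣ m` and
`wᵢ` a unit mod `Mᵢ`, and let `f ∣ m` be ODD such that every `Mᵢ` divisible by `f` is `f`, `2f`
or `4f`. Then for every odd primitive character `χ` mod `f`:
`∑_{Mᵢ = 4f} (1 - χ(2))(χ w̄ᵢ)⁻¹ + 2 ∑_{Mᵢ = 2f} (1 - χ(2))(χ w̄ᵢ)⁻¹ + 2 ∑_{Mᵢ = f} (χ w̄ᵢ)⁻¹ = 0`
(`w̄ᵢ = wᵢ mod f`; the weights are `φ(m)/φ(Mᵢ) = c/2, c, c` with `c = φ(m)/φ(f)`, the Euler factors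
`∏_{p ∣ Mᵢ}(1 - χ(p))` are `1 - χ(2)` at the even levels and `1` at `f`).
[cite: Aoki1983, Prop. 2.2 with Prop. 2.1; §9 (V-1) p. 53] -/
theorem IsHodge.rel_odd_conductor [NeZero m] {r : ℕ} {α : Fin r → ZMod m} (h : IsHodge α)
    {f : ℕ} [NeZero f] (hf : Odd f) (hfm : f ∣ m) {χ : DirichletCharacter ℂ f} (hχ : χ.Odd)
    (hprim : χ.IsPrimitive) (M : Fin r → ℕ) [∀ i, NeZero (M i)] (hM : ∀ i, M i ∣ m)
    (w : (i : Fin r) → ZMod (M i)) (hw : ∀ i, IsUnit (w i))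
    (hα : ∀ i, α i = ((m / M i : ℕ) : ZMod m) * ((ZMod.val (w i) : ℕ) : ZMod m))
    (hlev : ∀ i, f ∣ M i → M i = f ∨ M i = 2 * f ∨ M i = 4 * f) :
    ∑ i, (if M i = 4 * f then (1 - χ 2) * (χ (ZMod.cast (w i) : ZMod f))⁻¹
      else if M i = 2 * f then 2 * (1 - χ 2) * (χ (ZMod.cast (w i) : ZMod f))⁻¹
      else if M i = f then 2 * (χ (ZMod.cast (w i) : ZMod f))⁻¹ else 0) = 0 := by
  classical
  have hm0 : m ≠ 0 := NeZero.ne m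
  have hf0 : f ≠ 0 := NeZero.ne f
  have key := h.aoki_criterion hfm hχ hprim M hM w hw hα
  have hcop : Nat.Coprime 2 f := Nat.coprime_two_left.mpr hf
  have hcop4 : Nat.Coprime 4 f := by
    simpa [show (4 : ℕ) = 2 ^ 2 by norm_num] using hcop.pow_left 2
  have h2mem : (2 : ℕ) ∉ f.primeFactors := fun h2 ↦
    (Nat.not_even_iff_odd.mpr hf) (even_iff_two_dvd.mpr (Nat.dvd_of_mem_primeFactors h2))
  have hφf : ((f.totient : ℕ) : ℂ) ≠ 0 := by
    exact_mod_cast (Nat.totient_pos.mpr (Nat.pos_of_ne_zero hf0)).ne'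
  set c : ℂ := (m.totient : ℂ) / (f.totient : ℂ) with hc
  have hc0 : c ≠ 0 := div_ne_zero
    (by exact_mod_cast (Nat.totient_pos.mpr (Nat.pos_of_ne_zero hm0)).ne') hφf
  have hne12 : f ≠ 2 * f := by omega
  have hne14 : f ≠ 4 * f := by omega
  have hne24 : 2 * f ≠ 4 * f := by omega
  have hterm : ∀ i, (if f ∣ M i then ((m.totient : ℂ) / ((M i).totient : ℂ)) *
        (∏ p ∈ (M i).primeFactors, (1 - χ p)) * (χ (ZMod.cast (w i) : ZMod f))⁻¹ else 0) =
      (c / 2) * (if M i = 4 * f then (1 - χ 2) * (χ (ZMod.cast (w i) : ZMod f))⁻¹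
        else if M i = 2 * f then 2 * (1 - χ 2) * (χ (ZMod.cast (w i) : ZMod f))⁻¹
        else if M i = f then 2 * (χ (ZMod.cast (w i) : ZMod f))⁻¹ else 0) := by
    intro i
    by_cases hfi : f ∣ M i
    · rw [if_pos hfi]
      rcases hlev i hfi with h1 | h2 | h4
      · -- exact level `f`
        have ht : ((M i).totient : ℂ) = f.totient := by rw [h1]
        have hp : ∏ p ∈ (M i).primeFactors, (1 - χ (p : ZMod f)) = 1 := by
          rw [h1]; exact prod_primeFactors_one_sub_eq_one' χ
        rw [ht, hp, if_neg (by rw [h1]; exact hne14), if_neg (by rw [h1]; exact hne12), if_pos h1, hc]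
        ring
      · -- exact level `2f`
        have ht : ((M i).totient : ℂ) = f.totient := by
          rw [h2, Nat.totient_mul hcop, Nat.totient_two, one_mul]
        have hp : ∏ p ∈ (M i).primeFactors, (1 - χ (p : ZMod f)) = 1 - χ 2 := by
          rw [h2, Nat.primeFactors_mul two_ne_zero hf0, Nat.prime_two.primeFactors,
            show ({2} ∪ f.primeFactors : Finset ℕ) = insert 2 f.primeFactors from rfl,
            Finset.prod_insert h2mem, prod_primeFactors_one_sub_eq_one' χ, mul_one,
            Nat.cast_ofNat]
        rw [ht, hp, if_neg (by rw [h2]; exact hne24), if_pos h2, hc]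
        ring
      · -- exact level `4f`
        have ht : ((M i).totient : ℂ) = 2 * f.totient := by
          rw [h4, Nat.totient_mul hcop4, show (4 : ℕ).totient = 2 by decide]
          push_cast; ring
        have hp : ∏ p ∈ (M i).primeFactors, (1 - χ (p : ZMod f)) = 1 - χ 2 := by
          rw [h4, Nat.primeFactors_mul four_ne_zero hf0,
            show (4 : ℕ).primeFactors = {2} by
              rw [show (4 : ℕ) = 2 ^ 2 by norm_num,
                Nat.primeFactors_prime_pow two_ne_zero Nat.prime_two],
            show ({2} ∪ f.primeFactors : Finset ℕ) = insert 2 f.primeFactors from rfl,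
            Finset.prod_insert h2mem, prod_primeFactors_one_sub_eq_one' χ, mul_one,
            Nat.cast_ofNat]
        rw [ht, hp, if_pos h4, hc]
        field_simp
    · have hne4 : ¬ M i = 4 * f := fun h4 ↦ hfi (h4 ▸ dvd_mul_left f 4)
      have hne2 : ¬ M i = 2 * f := fun h2 ↦ hfi (h2 ▸ dvd_mul_left f 2)
      have hne1 : ¬ M i = f := fun h1 ↦ hfi (h1 ▸ dvd_refl f)
      rw [if_neg hfi, if_neg hne4, if_neg hne2, if_neg hne1, mul_zero]
  rw [Finset.sum_congr rfl (fun i _ ↦ hterm i), ← Finset.mul_sum] at key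
  exact (mul_eq_zero.mp key).resolve_left (div_ne_zero hc0 two_ne_zero)

/-- **[Aoki1983, Prop. 2.2] at an odd conductor met at the exact levels `f`, `2f`, `4f` — with
character values.** Under the hypotheses of `IsHodge.rel_odd_conductor`:
`∑_{Mᵢ = 4f} (1 - χ(2)⁻¹) χ(w̄ᵢ) + 2 ∑_{Mᵢ = 2f} (1 - χ(2)⁻¹) χ(w̄ᵢ) + 2 ∑_{Mᵢ = f} χ(w̄ᵢ) = 0` for
every odd primitive `χ` mod `f` (complex conjugate of `rel_odd_conductor`, `|χ(u)| = 1` on units).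
With `2v = -1` in `ℤ/f` the three kinds of points are twins `w̄ᵢ, v w̄ᵢ` of weight `1`, twins of
weight `2`, and single points of weight `2` — Aoki's "`τ_{2d₀}(α) = (φ(m)/φ(m/d₀)) (1, -2⁻¹, a₁')`"
and "`τ₄(α) = (1, -2⁻¹)(1, b') + (c')`". [cite: Aoki1983, Prop. 2.2; §9 (III-7) pp. 50–51, (V-1) p. 53] -/
theorem IsHodge.rel_odd_conductor_conj [NeZero m] {r : ℕ} {α : Fin r → ZMod m} (h : IsHodge α)
    {f : ℕ} [NeZero f] (hf : Odd f) (hfm : f ∣ m) {χ : DirichletCharacter ℂ f} (hχ : χ.Odd)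
    (hprim : χ.IsPrimitive) (M : Fin r → ℕ) [∀ i, NeZero (M i)] (hM : ∀ i, M i ∣ m)
    (w : (i : Fin r) → ZMod (M i)) (hw : ∀ i, IsUnit (w i))
    (hα : ∀ i, α i = ((m / M i : ℕ) : ZMod m) * ((ZMod.val (w i) : ℕ) : ZMod m))
    (hlev : ∀ i, f ∣ M i → M i = f ∨ M i = 2 * f ∨ M i = 4 * f) :
    ∑ i, (if M i = 4 * f then (1 - (χ 2)⁻¹) * χ (ZMod.cast (w i) : ZMod f)
      else if M i = 2 * f then 2 * (1 - (χ 2)⁻¹) * χ (ZMod.cast (w i) : ZMod f)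
      else if M i = f then 2 * χ (ZMod.cast (w i) : ZMod f) else 0) = 0 := by
  classical
  have key := h.rel_odd_conductor hf hfm hχ hprim M hM w hw hα hlev
  -- conjugate: `(χ y)⁻¹ = conj (χ y)`
  have hinv : ∀ y : ZMod f, (χ y)⁻¹ = starRingEnd ℂ (χ y) := by
    intro y
    by_cases hy : IsUnit y
    · exact Complex.inv_eq_conj (χ.unit_norm_eq_one hy.unit ▸ by rw [IsUnit.unit_spec])
    · rw [χ.map_nonunit hy, inv_zero, map_zero]
  have c2 : starRingEnd ℂ (2 : ℂ) = 2 := map_ofNat _ 2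
  have hterm : ∀ i, (if M i = 4 * f then (1 - (χ 2)⁻¹) * χ (ZMod.cast (w i) : ZMod f)
      else if M i = 2 * f then 2 * (1 - (χ 2)⁻¹) * χ (ZMod.cast (w i) : ZMod f)
      else if M i = f then 2 * χ (ZMod.cast (w i) : ZMod f) else 0) =
      starRingEnd ℂ (if M i = 4 * f then (1 - χ 2) * (χ (ZMod.cast (w i) : ZMod f))⁻¹
        else if M i = 2 * f then 2 * (1 - χ 2) * (χ (ZMod.cast (w i) : ZMod f))⁻¹
        else if M i = f then 2 * (χ (ZMod.cast (w i) : ZMod f))⁻¹ else 0) := by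
    intro i
    by_cases h4 : M i = 4 * f
    · rw [if_pos h4, if_pos h4, map_mul, map_sub, map_one, map_inv₀, ← hinv, ← hinv, inv_inv]
    · by_cases h2 : M i = 2 * f
      · rw [if_neg h4, if_pos h2, if_neg h4, if_pos h2, map_mul, map_mul, map_sub, map_one,
          map_inv₀, c2, ← hinv, ← hinv, inv_inv]
      · by_cases h1 : M i = f
        · rw [if_neg h4, if_neg h2, if_pos h1, if_neg h4, if_neg h2, if_pos h1, map_mul, map_inv₀,
            c2, ← hinv, inv_inv]
        · rw [if_neg h4, if_neg h2, if_neg h1, if_neg h4, if_neg h2, if_neg h1, map_zero]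
  rw [Finset.sum_congr rfl fun i _ ↦ hterm i, ← map_sum, key, map_zero]

end OddConductor

end FermatCharacter

end Literature.AlgebraicGeometry.HodgeTheory
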